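import Summits.BirchSwinnertonDyer.BirchSwinnertonDyer.Theorems.AlignedTransportAtTwoMainConjectureOfRankZeroBSDAtTwoTwinValueDichotomy
import Summits.BirchSwinnertonDyer.BirchSwinnertonDyer.Theorems.AlignedTransportAtTwoMainConjectureOfRankZeroBSDAtTwoTwistSaturation
import Literature.NumberTheory.EllipticCurves.Greenberg1999.CharIdealInvolutionIdealForm
import HarnessLib

/-!
# Route `AlignedTransportAtTwo`, crux C2 `MainConjectureOfRankZeroBSDAtTwo` (stmt-BirchSwinnertonDyer-22298):
# THE TWIN-VALUE DOOR — `μ(X(W/ℚ_∞)) = 0` from the TWO special values of `char_Λ X` at the `ι`-fixed points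
# `T = 0` (Greenberg's Euler characteristic, KERNEL) and `T = −2` (the twin value, DISPLAYED), plus the `ι`-invariance
# of `char_Λ X` (Greenberg Thm. 1.14, PRINT) — no rational point, no twist, no modular symbol

HONEST FRAMING (cell `bsd-f1-sign2`, WIDTH-5 attached prover seat `bsd-line-att-p5` gen 49 on line `birth` of the lead
`bsd-line-att-p2`; `--supports` stmt-BirchSwinnertonDyer-22298, closes nothing; BSD is NOT proved by any of this; the crux
C2, its verdict «blocked-on `Rank1Residual.GreenbergMuConjectureIrreducible`» and every registered stub (P / T / Kμ / LimDoor
/ MuIneqʳ / PFμ⁺) are untouched). THEOREMS ONLY — no `def`, no instance, no named fact, no `sorry`. PRINT binder: `h114` =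
Greenberg, LNM 1716 (1999), Thm. 1.14 («the characteristic ideal of `X_E(F_∞)` is fixed by the involution `ι`», every `p`;
tree named fact `Greenberg1999_thm114_charIdeal_iota_invariant`). Greenberg's Thm. 4.1 is the KERNEL theorem
`thm41_charValue_rankZero_anyPrime_holds` (cell bsd-2adic), as in the sibling `…TwistSaturation`.

THE POINT. Every door of the lineage so far certifies `μ₂ = 0` by exhibiting ZEROS of a generator `f_X` of `char_Λ X(W/ℚ_∞)` at
`T = −2` (rational points on the `√2`-twist `W⁽²⁾`: g38 twist reading, g46 twist saturation, g47/g48 twist orbits) against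
Greenberg's VALUE `‖f_X(0)‖₂ = 2^{−e(W)}`, `e(W) = ord₂ ∏c_ℓ + 2·ord₂ #Ẽ(𝔽₂)[2^∞] + ord₂ #Sel_{2^∞}(W/ℚ) − 2·ord₂ #W(ℚ)[2^∞]`
(g37 `…CyclotomicLayerWeightEuler`). This file uses the VALUE at `T = −2` instead of a zero there. The involution
`ι : T ↦ (1+T)⁻¹ − 1` fixes exactly the two points `0` and `−2` of the open disc; by the sibling Λ-algebra
(`…TwinValueDichotomy.mu_add_two_le_of_ne`), for an `ι`-stable `F` vanishing at neither point, **`ord₂ F(0) ≠ ord₂ F(−2) ⟹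
μ(F) + 2 ≤ min(ord₂ F(0), ord₂ F(−2))`**. With `F = f_X` (`ι`-stable by Thm. 1.14; `‖f_X(0)‖₂ = 2^{−e(W)}` by Thm. 4.1):

* §1 `valuation_eq_of_norm_eq_two_inv_pow` (bookkeeping), `iotaStable_charGen_of_thm114` (Thm. 1.14 in the tree's `invol` currency).
* §2 (datum level; `W/ℚ` globally minimal, good ordinary at `2`, `Sel_{2^∞}(W/ℚ)` finite, `(κ, γ)` the normalised cyclotomic datum,
  `D` any dual datum, `f_X` any generator of `char_Λ D.X`, `f_X(−2) := BlindLever.evalAt (−2) f_X`) ★★ `mu_add_two_le_of_twinValue`: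
  **`e(W) ≠ ord₂ f_X(−2) ⟹ μ(X) + 2 ≤ e(W) ∧ μ(X) + 2 ≤ ord₂ f_X(−2)`**; ★★★ `mu_eq_zero_of_twinValue`: **`e(W) = 2 < ord₂ f_X(−2)`
  OR `ord₂ f_X(−2) = 2 < e(W)` ⟹ `μ(X(W/ℚ_∞)) = 0`**.
* §3 (the seed cell, modulo PRINT {`h17` Kato 17.4 (1)(2), `hper`, `hmod`, `hGZK`, `h114`}, C2's own binders `r_an = 0`, `BSD(W,2)`, good
  ordinary, no rational `2`-torsion) ★★★ `mazurMainConjecture_two_of_bsdp_of_twinValue`: the TWIN VALUE displayed at every normalised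
  datum (`∃` generator `f_X` with `f_X(−2) ≠ 0` and `{e(W), ord₂ f_X(−2)} ∋ 2`, the two distinct) ⟹ **`MazurMainConjecture W 2`**
  (Seed door `mazurMainConjecture_two_of_bsdp_of_mu_eq_zero`); headline forms `…_of_weight_two` (`e(W) = 2`, `3 ≤ ord₂ f_X(−2)`:
  the CLEAN `a₂ = +1` cell) and `…_of_twin_two` (`ord₂ f_X(−2) = 2`, `3 ≤ e(W)`: e.g. the `a₂ = −1` anchors, `e(W) = 4`).

READING OF THE TWIN VALUE (not used in any proof here; memo `Cruxes/MainConjectureOfRankZeroBSDAtTwo/TWIN-VALUE-att-p5-g49.md`):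
`‖f_X(0)·f_X(−2)‖₂⁻¹ = #X/ω₁X`-type Euler characteristic of `W` over the first layer `ℚ_1 = ℚ(√2)`; by Greenberg's Thm. 4.1 over the
number field `ℚ(√2)` (tree PRINT fact `thm41_charValue_rankZero_numberField_anyPrime`, one ramified prime over `2` with `#Ẽ(𝔽₂)²`) and
BSD over `ℚ(√2)` versus `ℚ`, on the clean cell `ord₂ f_X(−2) = ord₂ #Ш(W/ℚ(√2))[2^∞] = ord₂(√8·L(W⁽²⁾,1)/Ω_W) = 1 + ord₂ u + ord₂ ∏c(B) +
ord₂ #Ш(B)` for the minimal model `B` of `W⁽²⁾` (`u = Ω_B√2/Ω_W`); the analytic shadow is the tree THEOREM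
`hasSum_coeff_padicLFunction_two_neg_two` (`L₂(W,−2) = α⁻³·S₈(f)`, Mazur–Tate–Teitelbaum at `χ₈`). Census (145 non-saturated clean
`a₂ = +1` seeds of g48): `u = ½`, `B` of type `I₈*` with `c₂(B) = 4` throughout, so `ord₂ f_X(−2) = 2 + ord₂ #Ш(W⁽²⁾)`: the door
LIGHTS the 18 seeds with `Ш_an(W⁽²⁾) = 4` (twin value `4`) WITHOUT a point search and is SILENT (twin value `2 = e(W)`) on the 113
dark ones — «doubly dark». HONEST SCOPE: the twin value is a DISPLAYED per-curve input of the same tier as `O1.TowerGapAtTwo`; no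
particular curve is certified in this file; BSD is not proved by any of this.

References: R. Greenberg, LNM 1716 (1999), Thm. 1.14 (p. 68), Thm. 4.1 (p. 102), §4 p. 107 [GreenbergLNM1716]; B. Mazur, J. Tate,
J. Teitelbaum, Invent. Math. 84 (1986) Ch. I §17 [MazurTateTeitelbaum1986Invent]; K. Kato, Astérisque 295 (2004), Thm. 17.4
[Kato2004Asterisque]; L. Washington, GTM 83, §7.1, §13.2 [Washington1997]; A. Abbes, E. Ullmo, Compositio 103 (1996) Thm. A [AbbesUllmo1996].
-/

set_option linter.dupNamespace false
set_option autoImplicit false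

noncomputable section

open scoped Classical MatrixGroups ModularForm

namespace Summit.BirchSwinnertonDyer.BirchSwinnertonDyer.Theorems.AlignedTransportAtTwoTwinValue

open PowerSeries CongruenceSubgroup WeierstrassCurve Literature.NumberTheory.EllipticCurves
  Literature.NumberTheory.EllipticCurves.IwasawaAlgebra
  Literature.NumberTheory.EllipticCurves.ModularForms
  Literature.NumberTheory.EllipticCurves.Rank1Residual
  Literature.NumberTheory.EllipticCurves.Rank1Residual.Typed
  Literature.NumberTheory.EllipticCurves.Greenberg1999
  Summit.BirchSwinnertonDyer.Rank1Residual
  Summit.BirchSwinnertonDyer.Rank1Residual.X1.MuLambda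
  Summit.BirchSwinnertonDyer.Rank1Residual.X1.MuPart
  Summit.BirchSwinnertonDyer.Rank1Residual.X5
  Summit.BirchSwinnertonDyer.Rank1Residual.F1Sign2
  Summit.BirchSwinnertonDyer.Rank1Residual.Supersingular
  Summit.BirchSwinnertonDyer.Rank1Residual.Supersingular.BlindLever
  Summit.BirchSwinnertonDyer.BirchSwinnertonDyer.Theorems.Rank1ResidualX1Defs
  Summit.BirchSwinnertonDyer.BirchSwinnertonDyer.Theorems.AlignedTransportAtTwoSeed
  Summit.BirchSwinnertonDyer.BirchSwinnertonDyer.Theorems.AlignedTransportAtTwoCyclotomicLayerWeightEuler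
  Summit.BirchSwinnertonDyer.BirchSwinnertonDyer.Theorems.AlignedTransportAtTwoTwistSaturation
  Summit.BirchSwinnertonDyer.BirchSwinnertonDyer.Theorems.AlignedTransportAtTwoTwinValueAlgebra
  Summit.BirchSwinnertonDyer.BirchSwinnertonDyer.Theorems.TwoAdicEulerCharKernel

/-! ## §1 Bookkeeping: norms versus `2`-adic orders; Thm. 1.14 in `invol` currency -/

section Bookkeeping

/-- `‖x‖₂ = 2^{−w}` for `x ∈ ℤ₂` means `x ≠ 0` and `ord₂ x = w`. [folklore] -/
theorem valuation_eq_of_norm_eq_two_inv_pow {x : ℤ_[2]} {w : ℕ} (h : ‖x‖ = (2 : ℝ)⁻¹ ^ w) : x ≠ 0 ∧ x.valuation = w := by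
  have hx : x ≠ 0 := by
    intro h0
    rw [h0, norm_zero] at h
    exact (pow_ne_zero _ (by norm_num : ((2 : ℝ)⁻¹) ≠ 0)) h.symm
  refine ⟨hx, ?_⟩
  have h1 := PadicInt.norm_eq_zpow_neg_valuation hx
  rw [h] at h1
  have h2 : ((2 : ℕ) : ℝ) ^ (-(w : ℤ)) = ((2 : ℕ) : ℝ) ^ (-(x.valuation : ℤ)) := by
    rw [← h1, zpow_neg, zpow_natCast, inv_pow]; norm_num
  have h3 := zpow_right_injective₀ (by norm_num) (by norm_num) h2
  omega

/-- **Greenberg's Thm. 1.14 in the tree's `invol` currency**: granted the named fact `h114`, for `W/ℚ` globally minimal and good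
ordinary at `p`, the cyclotomic `ℤ_p`-extension with topological generator `γ`, a finitely generated `Λ`-torsion dual datum `D` and a
generator `f` of `char_Λ D.X`: `ι f = u · f` for a unit `u` (`ι = IwasawaAlgebra.invol p`, `ι T = (1+T)⁻¹ − 1`).
[cite: GreenbergLNM1716, Thm. 1.14 (p. 68)] -/
theorem iotaStable_charGen_of_thm114 (h114 : Greenberg1999_thm114_charIdeal_iota_invariant)
    (W : WeierstrassCurve ℚ) [W.IsElliptic] [W.IsGloballyMinimal] {p : ℕ} [Fact p.Prime] (hord : IsOrdinaryAt W p)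
    {κ : ZpExtension ℚ p} {γ : Field.absoluteGaloisGroup ℚ} (hκ : κ.IsCyclotomic) (hγ : κ.IsTopGenerator γ)
    (D : W.SelmerDualData κ γ) [Module.Finite (IwasawaAlgebra p) D.X] (hD : D.IsTorsion)
    {f : IwasawaAlgebra p} (hchar : D.charIdeal = Ideal.span {f}) :
    ∃ u : (IwasawaAlgebra p)ˣ, invol p f = u * f := by
  obtain ⟨u, hu⟩ := h114 W p (Or.inl hord) κ γ hκ hγ D hD f hchar (invSubOne p) (one_add_X_mul_invSubOne_add_one p)
  exact ⟨u, by rw [invol_apply]; exact hu⟩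

end Bookkeeping

/-! ## §2 Datum level: the twin-value door for `X(W/ℚ_∞)` -/

section Datum

variable (κ : ZpExtension ℚ 2) (hκ : κ.IsCyclotomic) {γ : Field.absoluteGaloisGroup ℚ} (hγ : κ.IsTopGenerator γ)
  (hγ' : IsCyclotomicVariable 2 γ) (W : WeierstrassCurve ℚ) [W.IsElliptic] [W.IsGloballyMinimal]

include hκ hγ hγ' in
/-- ★★ **THE TWIN-VALUE INEQUALITY for `X(W/ℚ_∞)`.** `W/ℚ` globally minimal, good ordinary at `2`, `Sel_{2^∞}(W/ℚ)` finite; `(κ, γ)`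
the cyclotomic `ℤ₂`-extension with a normalised topological generator, `D` any Pontryagin-dual datum of `Sel_{2^∞}(W/ℚ_∞)`, `f_X` any
generator of `char_Λ D.X`; `#W(ℚ)[2^∞] = 2^t`, `#Ẽ(𝔽₂)[2^∞] = 2^e`, `#Sel_{2^∞}(W/ℚ) = 2^s`, `v = ord₂ ∏c_ℓ`, Euler weight
`w = v + 2e + s − 2t`; PRINT `h114` (Thm. 1.14). If `f_X(−2) ≠ 0` and the TWIN VALUE `ord₂ f_X(−2)` differs from `w`, then
**`μ(X) + 2 ≤ w` and `μ(X) + 2 ≤ ord₂ f_X(−2)`**. Proof: `‖f_X(0)‖₂ = 2^{−w}` (Thm. 4.1, kernel), `ι f_X = u·f_X` (Thm. 1.14), the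
twin-value dichotomy of `…TwinValueDichotomy`, `μ(f_X) = μ(X)`. [cite: GreenbergLNM1716, Thm. 1.14 (p. 68), Thm. 4.1 (p. 102), §4 p. 107]
[cite: MazurTateTeitelbaum1986Invent, Ch. I §17] [cite: Washington1997, §13.2] -/
theorem mu_add_two_le_of_twinValue (h114 : Greenberg1999_thm114_charIdeal_iota_invariant) (hord : IsOrdinaryAt W 2)
    (D : W.SelmerDualData κ γ) (hfin : Finite (W.selmerGroupPInfty 2)) {t e s : ℕ}
    (ht : Nat.card (AddCommGroup.primaryComponent W.toAffine.Point 2) = 2 ^ t)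
    (he : Nat.card (AddCommGroup.primaryComponent ((integralModelInt W).map (Int.castRingHom (ZMod 2))).toAffine.Point 2) = 2 ^ e)
    (hs : Nat.card (W.selmerGroupPInfty 2) = 2 ^ s) {fX : IwasawaAlgebra 2} (hchar : D.charIdeal = Ideal.span {fX})
    (h2 : evalAt (-2 : ℤ_[2]) fX ≠ 0)
    (hne : padicValNat 2 W.tamagawaProduct + 2 * e + s - 2 * t ≠ (evalAt (-2 : ℤ_[2]) fX).valuation) :
    D.mu + 2 ≤ padicValNat 2 W.tamagawaProduct + 2 * e + s - 2 * t ∧ D.mu + 2 ≤ (evalAt (-2 : ℤ_[2]) fX).valuation := by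
  haveI : Module.Finite (IwasawaAlgebra 2) D.X := D.module_finite_holds hγ
  have hD : D.IsTorsion := isTorsion_of_finite κ hκ hγ W hord D hfin
  obtain ⟨-, hnorm⟩ := norm_constantCoeff_charGen_eq_of_thm41 W thm41_charValue_rankZero_anyPrime_holds
    ((isOrdinaryAt_iff W 2).mp hord).1 ((isOrdinaryAt_iff W 2).mp hord).2 hκ hγ hγ' D hD hchar hfin ht he hs
  obtain ⟨hc0, hval⟩ := valuation_eq_of_norm_eq_two_inv_pow hnorm
  have hfXne : fX ≠ 0 := fun h0 ↦ hc0 (by rw [h0, map_zero])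
  have hι := iotaStable_charGen_of_thm114 h114 W hord hκ hγ D hD hchar
  have hne' : (constantCoeff fX).valuation ≠ (evalAt (-2 : ℤ_[2]) fX).valuation := by rw [hval]; exact hne
  obtain ⟨ha, hb⟩ := mu_add_two_le_of_ne hfXne hι hc0 h2 hne'
  have hmufX : mu fX = D.mu := mu_generator_eq_muInvariant D.X hD hfXne hchar
  rw [hval] at ha
  rw [← hmufX]
  exact ⟨ha, hb⟩

include hκ hγ hγ' in
/-- ★★★ **THE TWIN-VALUE DOOR, datum level.** Same hypotheses; if ONE of the Euler weight `w = v + 2e + s − 2t` and the twin value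
`ord₂ f_X(−2)` equals `2` and the other does not (with `f_X(−2) ≠ 0`), then **`μ(X(W/ℚ_∞)) = 0`**. (Weight-`2` form: the clean
`a₂ = +1` cell, `w = 2 < ord₂ f_X(−2)`; twin-`2` form: e.g. `a₂ = −1`, `w = 4 > 2 = ord₂ f_X(−2)`.) NO rational point, NO twist, NO
modular symbol. [cite: GreenbergLNM1716, Thm. 1.14 (p. 68), Thm. 4.1 (p. 102)] [cite: MazurTateTeitelbaum1986Invent, Ch. I §17] -/
theorem mu_eq_zero_of_twinValue (h114 : Greenberg1999_thm114_charIdeal_iota_invariant) (hord : IsOrdinaryAt W 2)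
    (D : W.SelmerDualData κ γ) (hfin : Finite (W.selmerGroupPInfty 2)) {t e s : ℕ}
    (ht : Nat.card (AddCommGroup.primaryComponent W.toAffine.Point 2) = 2 ^ t)
    (he : Nat.card (AddCommGroup.primaryComponent ((integralModelInt W).map (Int.castRingHom (ZMod 2))).toAffine.Point 2) = 2 ^ e)
    (hs : Nat.card (W.selmerGroupPInfty 2) = 2 ^ s) {fX : IwasawaAlgebra 2} (hchar : D.charIdeal = Ideal.span {fX})
    (h2 : evalAt (-2 : ℤ_[2]) fX ≠ 0)
    (htwo : padicValNat 2 W.tamagawaProduct + 2 * e + s - 2 * t = 2 ∨ (evalAt (-2 : ℤ_[2]) fX).valuation = 2)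
    (hne : padicValNat 2 W.tamagawaProduct + 2 * e + s - 2 * t ≠ (evalAt (-2 : ℤ_[2]) fX).valuation) : D.mu = 0 := by
  obtain ⟨ha, hb⟩ := mu_add_two_le_of_twinValue κ hκ hγ hγ' W h114 hord D hfin ht he hs hchar h2 hne
  rcases htwo with h | h <;> omega

end Datum

/-! ## §3 On the seed cell, modulo PRINT: the twin value ⟹ Mazur's main conjecture at `2` -/

section Seed

variable (W : WeierstrassCurve ℚ) [W.IsElliptic] [W.IsGloballyMinimal]

/-- ★★★ **THE TWIN-VALUE DOOR ON THE SEED CELL, modulo PRINT.** `W` globally minimal, good ordinary at `2`, no rational point of order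
`2`, `r_an(W) = 0`, `BSD(W,2)` (C2's own binders); PRINT `h17` (Kato 17.4 (1)(2) at `2`), `hper` (period unit), `hmod` (modularity),
`hGZK` (Gross–Zagier–Kolyvagin), `h114` (Greenberg Thm. 1.14) — Greenberg's Thm. 4.1 is the tree theorem. DATA: `#W(ℚ)[2^∞] = 2^t`,
`#Ẽ(𝔽₂)[2^∞] = 2^e`, `#Sel_{2^∞}(W/ℚ) = 2^s`, and at every normalised cyclotomic dual datum the DISPLAYED TWIN VALUE: a generator `f_X`
of `char_Λ X` with `f_X(−2) ≠ 0`, one of `{w, ord₂ f_X(−2)}` equal to `2` (`w = ord₂ ∏c_ℓ + 2e + s − 2t`) and the two distinct. Then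
**Mazur's `2`-adic main conjecture holds for `W`** (§2 + the Seed door `mazurMainConjecture_two_of_bsdp_of_mu_eq_zero`; C2's
analytic-`μ` binder is idle). [cite: Kato2004Asterisque, Thm. 17.4 (1)(2) (p. 273)] [cite: GreenbergLNM1716, Thm. 1.14 (p. 68), Thm. 4.1 (p. 102)]
[cite: AbbesUllmo1996, Thm. A] -/
theorem mazurMainConjecture_two_of_bsdp_of_twinValue
    (h17 : ∀ [NeZero (W.conductorNorm ℤ)] (f : CuspForm (Gamma0 (W.conductorNorm ℤ)) 2),
      kato_divisibility_allPrimes W 2 (f := f))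
    (hper : realPeriodRat_eq_unit_mul_plusPeriod_two) (hmod : nonempty_modularParametrizationData)
    (hGZK : rank_eq_analyticRank_of_analyticRank_le_one) (h114 : Greenberg1999_thm114_charIdeal_iota_invariant)
    (hord : IsOrdinaryAt W 2) (ht2 : ∀ x : ℚ, ¬ HasRationalTwoTorsionX W x) (hr : W.analyticRank = 0) (hbsd : BSDp W 2)
    {t e s : ℕ} (ht : Nat.card (AddCommGroup.primaryComponent W.toAffine.Point 2) = 2 ^ t)
    (he : Nat.card (AddCommGroup.primaryComponent ((integralModelInt W).map (Int.castRingHom (ZMod 2))).toAffine.Point 2) = 2 ^ e)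
    (hs : Nat.card (W.selmerGroupPInfty 2) = 2 ^ s)
    (htwin : ∀ (κ : ZpExtension ℚ 2) (γ : Field.absoluteGaloisGroup ℚ), κ.IsCyclotomic → κ.IsTopGenerator γ →
      IsCyclotomicVariable 2 γ → ∀ D : W.SelmerDualData κ γ, ∃ fX : IwasawaAlgebra 2, D.charIdeal = Ideal.span {fX} ∧
        evalAt (-2 : ℤ_[2]) fX ≠ 0 ∧
        (padicValNat 2 W.tamagawaProduct + 2 * e + s - 2 * t = 2 ∨ (evalAt (-2 : ℤ_[2]) fX).valuation = 2) ∧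
        padicValNat 2 W.tamagawaProduct + 2 * e + s - 2 * t ≠ (evalAt (-2 : ℤ_[2]) fX).valuation) :
    MazurMainConjecture W 2 := by
  have hfin : Finite (W.selmerGroupPInfty 2) := finite_selmerGroupPInfty_two_of_analyticRank_eq_zero W hGZK hr
  refine mazurMainConjecture_two_of_bsdp_of_mu_eq_zero W h17 thm41_charValue_rankZero_anyPrime_holds hper hmod hGZK hord ht2 hr
    hbsd fun κ γ hκ hγ hγ' D _ ↦ ?_
  obtain ⟨fX, hchar, h2, htwo, hne⟩ := htwin κ γ hκ hγ hγ' D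
  exact mu_eq_zero_of_twinValue κ hκ hγ hγ' W h114 hord D hfin ht he hs hchar h2 htwo hne

/-- ★★★ **WEIGHT-TWO FORM (the clean `a₂ = +1` cell):** as above with `ord₂ ∏c_ℓ + 2e + s − 2t = 2` (e.g. `E(ℚ)[2] = 0`, `#Ẽ(𝔽₂) = 2`,
`Ш(W/ℚ)[2] = 0`, `∏c_ℓ` odd) and, at every normalised datum, a generator with **`f_X(−2) ≠ 0`, `3 ≤ ord₂ f_X(−2)`** ⟹
`MazurMainConjecture W 2`. [cite: Kato2004Asterisque, Thm. 17.4 (1)(2) (p. 273)] [cite: GreenbergLNM1716, Thm. 1.14 (p. 68), Thm. 4.1 (p. 102)] -/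
theorem mazurMainConjecture_two_of_bsdp_of_twinValue_of_weight_two
    (h17 : ∀ [NeZero (W.conductorNorm ℤ)] (f : CuspForm (Gamma0 (W.conductorNorm ℤ)) 2),
      kato_divisibility_allPrimes W 2 (f := f))
    (hper : realPeriodRat_eq_unit_mul_plusPeriod_two) (hmod : nonempty_modularParametrizationData)
    (hGZK : rank_eq_analyticRank_of_analyticRank_le_one) (h114 : Greenberg1999_thm114_charIdeal_iota_invariant)
    (hord : IsOrdinaryAt W 2) (ht2 : ∀ x : ℚ, ¬ HasRationalTwoTorsionX W x) (hr : W.analyticRank = 0) (hbsd : BSDp W 2)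
    {t e s : ℕ} (ht : Nat.card (AddCommGroup.primaryComponent W.toAffine.Point 2) = 2 ^ t)
    (he : Nat.card (AddCommGroup.primaryComponent ((integralModelInt W).map (Int.castRingHom (ZMod 2))).toAffine.Point 2) = 2 ^ e)
    (hs : Nat.card (W.selmerGroupPInfty 2) = 2 ^ s) (hw : padicValNat 2 W.tamagawaProduct + 2 * e + s - 2 * t = 2)
    (htwin : ∀ (κ : ZpExtension ℚ 2) (γ : Field.absoluteGaloisGroup ℚ), κ.IsCyclotomic → κ.IsTopGenerator γ →
      IsCyclotomicVariable 2 γ → ∀ D : W.SelmerDualData κ γ, ∃ fX : IwasawaAlgebra 2, D.charIdeal = Ideal.span {fX} ∧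
        evalAt (-2 : ℤ_[2]) fX ≠ 0 ∧ 3 ≤ (evalAt (-2 : ℤ_[2]) fX).valuation) :
    MazurMainConjecture W 2 := by
  refine mazurMainConjecture_two_of_bsdp_of_twinValue W h17 hper hmod hGZK h114 hord ht2 hr hbsd ht he hs fun κ γ hκ hγ hγ' D ↦ ?_
  obtain ⟨fX, hchar, h2, h3⟩ := htwin κ γ hκ hγ hγ' D
  exact ⟨fX, hchar, h2, Or.inl hw, by omega⟩

/-- ★★★ **TWIN-TWO FORM (e.g. the `a₂ = −1` anchors, weight `4`):** as above with `3 ≤ ord₂ ∏c_ℓ + 2e + s − 2t` and, at every normalised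
datum, a generator with **`f_X(−2) ≠ 0`, `ord₂ f_X(−2) = 2`** ⟹ `MazurMainConjecture W 2` — a weight-`4` curve is certified by a twin
value that is TOO SMALL for `μ ≥ 1`. [cite: Kato2004Asterisque, Thm. 17.4 (1)(2) (p. 273)] [cite: GreenbergLNM1716, Thm. 1.14 (p. 68), Thm. 4.1 (p. 102)] -/
theorem mazurMainConjecture_two_of_bsdp_of_twinValue_of_twin_two
    (h17 : ∀ [NeZero (W.conductorNorm ℤ)] (f : CuspForm (Gamma0 (W.conductorNorm ℤ)) 2),
      kato_divisibility_allPrimes W 2 (f := f))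
    (hper : realPeriodRat_eq_unit_mul_plusPeriod_two) (hmod : nonempty_modularParametrizationData)
    (hGZK : rank_eq_analyticRank_of_analyticRank_le_one) (h114 : Greenberg1999_thm114_charIdeal_iota_invariant)
    (hord : IsOrdinaryAt W 2) (ht2 : ∀ x : ℚ, ¬ HasRationalTwoTorsionX W x) (hr : W.analyticRank = 0) (hbsd : BSDp W 2)
    {t e s : ℕ} (ht : Nat.card (AddCommGroup.primaryComponent W.toAffine.Point 2) = 2 ^ t)
    (he : Nat.card (AddCommGroup.primaryComponent ((integralModelInt W).map (Int.castRingHom (ZMod 2))).toAffine.Point 2) = 2 ^ e)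
    (hs : Nat.card (W.selmerGroupPInfty 2) = 2 ^ s) (hw : 3 ≤ padicValNat 2 W.tamagawaProduct + 2 * e + s - 2 * t)
    (htwin : ∀ (κ : ZpExtension ℚ 2) (γ : Field.absoluteGaloisGroup ℚ), κ.IsCyclotomic → κ.IsTopGenerator γ →
      IsCyclotomicVariable 2 γ → ∀ D : W.SelmerDualData κ γ, ∃ fX : IwasawaAlgebra 2, D.charIdeal = Ideal.span {fX} ∧
        evalAt (-2 : ℤ_[2]) fX ≠ 0 ∧ (evalAt (-2 : ℤ_[2]) fX).valuation = 2) :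
    MazurMainConjecture W 2 := by
  refine mazurMainConjecture_two_of_bsdp_of_twinValue W h17 hper hmod hGZK h114 hord ht2 hr hbsd ht he hs fun κ γ hκ hγ hγ' D ↦ ?_
  obtain ⟨fX, hchar, h2, h3⟩ := htwin κ γ hκ hγ hγ' D
  exact ⟨fX, hchar, h2, Or.inr h3, by omega⟩

end Seed

end Summit.BirchSwinnertonDyer.BirchSwinnertonDyer.Theorems.AlignedTransportAtTwoTwinValue

end
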